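import Literature.Analysis.FluidPDE.MillerMiddleEigenvalueSupGronwall
import Literature.Analysis.FluidPDE.MillerMiddleEigenvalueCriterionProofs
import HarnessLib

/-!
# Miller's middle-eigenvalue criterion with a TIME-ONLY majorant: propagation along the Leray–Hopf evolution

search for candidate a priori estimates; no regularity claim (cell `pub-nsreg`, seat nsreg-p6 g7; bricks for the
cell nsreg-p1 ROUND-15 rung (ii) «λ₂⁺ ≤ ε/(T−t)»).

Analysis/FluidPDE proofs file (theorems only).  Twin of `exists_eWeakGradL2Sq_le_of_midStrain`
(`MillerMiddleEigenvalueCriterionProofs.lean`, Miller's class `L^p_t L^q_x`, `q < ∞`) at the endpoint `q = ∞` and in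
SHARP (time-resolved) form: for a classical solution on `ℝ³ × [0,T)` which is Leray–Hopf on `[0,T)` and a time-only
majorant `m(t) ≥ 0` of the middle principal strain, `λ₂(∇u(t,x)) ≤ m(t)` (two-frame form), which is integrable on
every `[0, b]`, `b < T` (NOT necessarily on `[0,T)` — the point of the rung),

* `eWeakGradL2Sq_le_exp_of_midStrain_sup` — along an `H¹`-regular interval `(α, β) ⊆ (0,T)`, `t₀ ∈ (α, β)`:
  `‖∇u(t)‖² ≤ exp (4 ∫_{t₀}^t m) ‖∇u(t₀)‖²` for `t ∈ [t₀, β)` (Tao patches from good times + the slab inequality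
  `miller_enstrophy_le_mul_exp_sup` + `exp_lintegral_chain`, word for word as in the tree's `q < ∞` proof);
* `limsup_eH1NormSq_lt_top_of_midStrain_sup` — hence `limsup_{t↑β} ‖u(t)‖²_{H¹} < ∞` at every right end `β < T`… and
  at `β ≤ b` whenever `∫₀ᵇ m < ∞`;
* `isH1RegularOn_Ioo_of_midStrain_sup` — so `u` is `H¹`-regular on `(0, T)` (Leray's continuation theorem
  `leray_continuation_H1_holds` on every `[0, b]`, `b < T`).

References: Miller, ARMA 235 (2020) = arXiv:1710.05569, Thm 1.1 (proof of Thm 5.2) [Miller2019]; Neustupa–Penel 2001,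
Thm 2 [NeustupaPenel2001]; Robinson–Rodrigo–Sadowski 2016, Lemma 8.16 [RobinsonRodrigoSadowski2016].
-/

noncomputable section

open MeasureTheory Set Function Filter Topology InnerProductSpace
open scoped ENNReal NNReal ContDiff RealInnerProductSpace

namespace Literature.Analysis.FluidPDE

variable {ν T : ℝ} {u₀ : EuclideanSpace ℝ (Fin 3) → EuclideanSpace ℝ (Fin 3)}
  {u : ℝ → EuclideanSpace ℝ (Fin 3) → EuclideanSpace ℝ (Fin 3)}
  {p : ℝ → EuclideanSpace ℝ (Fin 3) → ℝ}

/-- **Sharp propagation of the enstrophy under a time-only middle-strain majorant** (endpoint `q = ∞` of Miller 2019,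
Thm 1.1, time-resolved): along an `H¹`-regular interval `(α, β) ⊆ (0, T)` of a classical Leray–Hopf solution,
`‖∇u(t)‖² ≤ exp (4 ∫_{t₀}^t m) ‖∇u(t₀)‖²` for `t₀ ∈ (α, β)`, `t ∈ [t₀, β)`.
[cite: Miller2019, Thm 1.1 (proof of Thm 5.2)] [cite: RobinsonRodrigoSadowski2016, Lemma 8.16 (proof)] -/
theorem eWeakGradL2Sq_le_exp_of_midStrain_sup {c : ℝ} (hL2 : TaoH1AlmostRegularWith c) (hc : 0 < c)
    (hν : 0 < ν) (hLH : IsLerayHopfOn T ν 0 u₀ u) (hcl : IsClassicalNSSolutionOn (Ico 0 T) ν 0 u p)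
    {m : ℝ → ℝ} (hm0 : ∀ t, 0 ≤ m t)
    (hmaj : ∀ t ∈ Ico 0 T, ∀ x, ∃ v w : EuclideanSpace ℝ (Fin 3), ‖v‖ = 1 ∧ ‖w‖ = 1 ∧
      ⟪v, w⟫ = 0 ∧ ∀ α β : ℝ,
        ⟪fderiv ℝ (u t) x (α • v + β • w), α • v + β • w⟫ ≤ m t * (α ^ 2 + β ^ 2))
    (hA : ∀ b < T, ∫⁻ t in Ioo 0 b, ENNReal.ofReal (m t) ≠ ⊤)
    {α β : ℝ} (hα : 0 ≤ α) (hβ : β ≤ T) (hreg : IsH1RegularOn (Ioo α β) u)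
    {t₀ : ℝ} (ht₀ : t₀ ∈ Ioo α β) {t : ℝ} (ht : t ∈ Ico t₀ β) :
    eWeakGradL2Sq (u t) ≤
      ENNReal.ofReal (Real.exp (4 * (∫⁻ σ in Ioo t₀ t, ENNReal.ofReal (m σ)).toReal)) *
        eWeakGradL2Sq (u t₀) := by
  -- notation
  set a : ℝ → ℝ≥0∞ := fun σ => ENNReal.ofReal (m σ) with ha
  set y₀ : ℝ≥0∞ := eWeakGradL2Sq (u t₀) with hy₀def
  have ht₀0 : 0 < t₀ := hα.trans_lt ht₀.1
  have htT : t < T := ht.2.trans_le hβ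
  -- good restarting times
  have hgood : ∀ᵐ s ∂(volume.restrict (Ioo 0 T)),
      IsLerayHopfOn (T - s) ν 0 (u s) (fun t => u (t + s)) := hLH.ae_isLerayHopfOn_restart hν.le
  -- a uniform `H¹` bound on the compact `[(α + t₀)/2, t]`
  have hKsub : Icc ((α + t₀) / 2) t ⊆ Ioo α β := fun s hs =>
    ⟨lt_of_lt_of_le (by linarith [ht₀.1]) hs.1, hs.2.trans_lt ht.2⟩
  obtain ⟨M, hM, hbound⟩ := hreg.exists_forall_le isCompact_Icc hKsub
  set Am : ℝ := M.toReal with hAm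
  have hAm0 : 0 ≤ Am := ENNReal.toReal_nonneg
  set τM : ℝ := c * ν ^ 3 / (Am ^ 2 + 1) with hτM
  have hτM0 : 0 < τM := by positivity
  have hτMc : Am ^ 2 * τM ≤ c * ν ^ 3 := by
    rw [hτM, mul_div_assoc']
    rw [div_le_iff₀ (by positivity)]
    nlinarith [mul_pos hc (pow_pos hν 3)]
  -- the propagated property
  set A : ℝ → ℝ := fun τ => (∫⁻ σ in Ioo t₀ τ, a σ).toReal with hAdef
  set P : ℝ → Prop := fun τ => eWeakGradL2Sq (u τ) ≤ ENNReal.ofReal (Real.exp (4 * A τ)) * y₀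
    with hPdef
  have hPt : P t := by
    refine forall_Icc_of_local_propagation (a := t₀) (b := t) (P := P) ?_ ?_ t ⟨ht.1, le_rfl⟩
    · -- `P t₀`
      simp only [hPdef, hAdef, Ioo_self, Measure.restrict_empty, lintegral_zero_measure,
        ENNReal.toReal_zero, mul_zero, Real.exp_zero, ENNReal.ofReal_one, one_mul, hy₀def, le_refl]
    · -- local propagation around `σ ∈ [t₀, t]`
      intro σ hσ
      have hσT : σ ≤ T := (hσ.2.trans ht.2.le).trans hβ
      -- a good time `s` just below `σ`
      have hlo : 0 ≤ max ((α + t₀) / 2) (σ - τM / 2) := le_max_of_le_left (by linarith)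
      have hlt : max ((α + t₀) / 2) (σ - τM / 2) < σ :=
        max_lt (by linarith [hσ.1, ht₀.1]) (by linarith)
      obtain ⟨s, hs, hLHs⟩ := exists_mem_Ioo_of_ae_restrict_Ioo hlo hlt hσT hgood
      have hs1 : (α + t₀) / 2 < s := (le_max_left _ _).trans_lt hs.1
      have hs2 : σ - τM / 2 < s := (le_max_right _ _).trans_lt hs.1
      have hs0 : 0 < s := lt_of_le_of_lt (by linarith) hs1
      have hsT : s < T := hs.2.trans_le hσT
      have hsK : s ∈ Icc ((α + t₀) / 2) t := ⟨hs1.le, hs.2.le.trans hσ.2⟩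
      have hAs : eH1NormSq (u s) ≤ ENNReal.ofReal Am := by
        rw [hAm, ENNReal.ofReal_toReal hM.ne]; exact hbound s hsK
      set τ' : ℝ := min τM (T - s) with hτ'def
      refine ⟨min (σ - s) (τM / 2), lt_min (sub_pos.2 hs.2) (by positivity), ?_⟩
      intro τ₁ hτ₁ τ₂ hτ₂ hτ₁σ hτ₁₂ hτ₂σ hP1
      rcases eq_or_lt_of_le hτ₁₂ with heq | hlt12
      · rw [← heq]; exact hP1
      -- the patch from `s` covers `[τ₁, τ₂]`
      have hδ1 : min (σ - s) (τM / 2) ≤ σ - s := min_le_left _ _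
      have hδ2 : min (σ - s) (τM / 2) ≤ τM / 2 := min_le_right _ _
      have hsτ₁ : s < τ₁ := by linarith
      have hτ₂T : τ₂ < T := lt_of_le_of_lt hτ₂.2 htT
      have hτ₂τ' : τ₂ - s < τ' := by
        refine lt_min (by linarith) ?_
        linarith [hτ₂.2, ht.2, hβ]
      set ε : ℝ := τ₁ - s with hεdef
      have hε0 : 0 < ε := sub_pos.2 hsτ₁
      have hετ' : ε < τ' := lt_trans (by rw [hεdef]; linarith) hτ₂τ'
      obtain ⟨w, π, hw, hbw, hbwt, hbπ, hrep⟩ := exists_tao_patch hL2 hν hLH ⟨hs0, hsT⟩ hLHs hAm0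
        hAs hτM0 hτMc (ε := ε) ⟨hε0, hετ'⟩
      -- translate to the slab `[0, τ' - ε]`, i.e. `u`-times `[τ₁, s + τ']`
      obtain ⟨hw', hbw', hbwt', hbπ'⟩ := taoSlab_translate hw hbw hbwt hbπ (e := ε) ⟨le_rfl, hετ'⟩
      have hL : 0 < τ' - ε := sub_pos.2 hετ'
      have hrep' : ∀ t' ∈ Icc 0 (τ' - ε), u (t' + τ₁) =ᵐ[volume] w (t' + ε) := by
        intro t' ht'
        have h := hrep (t' + ε) ⟨by linarith [ht'.1], by linarith [ht'.2]⟩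
        have e1 : t' + ε + s = t' + τ₁ := by rw [hεdef]; ring
        rwa [e1] at h
      have hs12 : τ₂ - τ₁ ∈ Ioc 0 (τ' - ε) := ⟨sub_pos.2 hlt12, by rw [hεdef]; linarith⟩
      -- on `u`-times `< T` the slices of the patch EQUAL those of the classical `u`
      have hrepD : ∀ t' ∈ Ioo 0 (τ₂ - τ₁),
          fderiv ℝ ((fun t => w (t + ε)) t') = fderiv ℝ (u (t' + τ₁)) := by
        intro t' ht'
        have ht'T : t' + τ₁ < T := by linarith [ht'.2]
        have ht'0 : 0 ≤ t' + τ₁ := by linarith [ht'.1, hτ₁.1]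
        have hcu : Continuous (u (t' + τ₁)) := (hcl.contDiff_velocity ⟨ht'0, ht'T⟩).continuous
        have hcw : Continuous (w (t' + ε)) :=
          (hw'.contDiff_velocity ⟨ht'.1.le, ht'.2.le.trans hs12.2⟩).continuous
        have heq : u (t' + τ₁) = w (t' + ε) :=
          (Continuous.ae_eq_iff_eq volume hcu hcw).1 (hrep' t' ⟨ht'.1.le, ht'.2.le.trans hs12.2⟩)
        simp only [heq]
      -- the time-shifted majorant is a majorant for the representative
      have hmaj' : ∀ t' ∈ Ioo 0 (τ₂ - τ₁), ∀ x, ∃ v w' : EuclideanSpace ℝ (Fin 3),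
          ‖v‖ = 1 ∧ ‖w'‖ = 1 ∧ ⟪v, w'⟫ = 0 ∧ ∀ α' β' : ℝ,
            ⟪fderiv ℝ ((fun t => w (t + ε)) t') x (α' • v + β' • w'), α' • v + β' • w'⟫ ≤
              (fun t'' => m (t'' + τ₁)) t' * (α' ^ 2 + β' ^ 2) := by
        intro t' ht' x
        have ht'T : t' + τ₁ < T := by linarith [ht'.2]
        have ht'0 : 0 ≤ t' + τ₁ := by linarith [ht'.1, hτ₁.1]
        rw [hrepD t' ht']
        exact hmaj (t' + τ₁) ⟨ht'0, ht'T⟩ x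
      -- the time weight of the representative
      have hint : ∫⁻ t' in Ioo 0 (τ₂ - τ₁), ENNReal.ofReal ((fun t'' => m (t'' + τ₁)) t') =
          ∫⁻ σ' in Ioo τ₁ τ₂, a σ' := by
        have h := setLIntegral_Ioo_comp_add_right a 0 (τ₂ - τ₁) τ₁
        rw [zero_add, sub_add_cancel] at h
        simpa only [ha] using h
      have hfinT : ∫⁻ σ' in Ioo 0 τ₂, a σ' ≠ ⊤ := hA τ₂ hτ₂T
      have hsub12 : Ioo τ₁ τ₂ ⊆ Ioo 0 τ₂ := Ioo_subset_Ioo_left (by linarith [hτ₁.1])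
      have hfin12 : ∫⁻ σ' in Ioo τ₁ τ₂, a σ' ≠ ⊤ := ne_top_of_le_ne_top hfinT (lintegral_mono_set hsub12)
      have hfinw : ∫⁻ t' in Ioo 0 (τ₂ - τ₁), ENNReal.ofReal ((fun t'' => m (t'' + τ₁)) t') ≠ ⊤ := by
        rw [hint]; exact hfin12
      -- the slab inequality with the `L^∞_x` majorant on the translated slab
      have hineq := miller_enstrophy_le_mul_exp_sup hν hL hw' hbw' hbwt' hbπ' (m := fun t'' => m (t'' + τ₁))
        (fun t'' => hm0 _) hs12 hmaj' hfinw
      rw [hint] at hineq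
      -- identify the enstrophies with those of `u`
      have hy2 : eWeakGradL2Sq (u τ₂) =
          ∫⁻ x, ENNReal.ofReal (frobeniusNormSq (fderiv ℝ (w (τ₂ - τ₁ + ε)) x)) := by
        have h := eWeakGradL2Sq_rep hw' ⟨hs12.1.le, hs12.2⟩ (hrep' (τ₂ - τ₁) ⟨hs12.1.le, hs12.2⟩)
        rwa [sub_add_cancel] at h
      have hy1 : eWeakGradL2Sq (u τ₁) =
          ∫⁻ x, ENNReal.ofReal (frobeniusNormSq (fderiv ℝ (w (0 + ε)) x)) := by
        have h := eWeakGradL2Sq_rep hw' ⟨le_rfl, hL.le⟩ (hrep' 0 ⟨le_rfl, hL.le⟩)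
        rwa [zero_add τ₁] at h
      have hstep : eWeakGradL2Sq (u τ₂) ≤
          ENNReal.ofReal (Real.exp (4 * (∫⁻ σ' in Ioo τ₁ τ₂, a σ').toReal)) * eWeakGradL2Sq (u τ₁) := by
        rw [hy2, hy1]
        exact hineq
      have hfin02 : ∫⁻ σ' in Ioo t₀ τ₂, a σ' ≠ ⊤ :=
        ne_top_of_le_ne_top hfinT (lintegral_mono_set (Ioo_subset_Ioo_left ht₀0.le))
      exact exp_lintegral_chain (y := fun τ => eWeakGradL2Sq (u τ)) (a := a) (C := 4) (y₀ := y₀)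
        hτ₁.1 hτ₁₂ hfin02 hP1 hstep
  exact hPt

/-- **No `H¹` blow-up before the majorant's integral diverges**: in the situation of
`eWeakGradL2Sq_le_exp_of_midStrain_sup`, `limsup_{t↑β} ‖u(t)‖²_{H¹} < ∞` at the right end of every `H¹`-regular
`(α, β) ⊆ (0, T)` with `∫₀^β m < ∞`. [cite: Miller2019, Thm 1.1 (proof of Thm 5.2)] -/
theorem limsup_eH1NormSq_lt_top_of_midStrain_sup {c : ℝ} (hL2 : TaoH1AlmostRegularWith c) (hc : 0 < c)
    (hν : 0 < ν) (hLH : IsLerayHopfOn T ν 0 u₀ u) (hcl : IsClassicalNSSolutionOn (Ico 0 T) ν 0 u p)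
    {m : ℝ → ℝ} (hm0 : ∀ t, 0 ≤ m t)
    (hmaj : ∀ t ∈ Ico 0 T, ∀ x, ∃ v w : EuclideanSpace ℝ (Fin 3), ‖v‖ = 1 ∧ ‖w‖ = 1 ∧
      ⟪v, w⟫ = 0 ∧ ∀ α β : ℝ,
        ⟪fderiv ℝ (u t) x (α • v + β • w), α • v + β • w⟫ ≤ m t * (α ^ 2 + β ^ 2))
    (hA : ∀ b < T, ∫⁻ t in Ioo 0 b, ENNReal.ofReal (m t) ≠ ⊤)
    {α β : ℝ} (hα : 0 ≤ α) (hαβ : α < β) (hβ : β ≤ T) (hAβ : ∫⁻ t in Ioo 0 β, ENNReal.ofReal (m t) ≠ ⊤)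
    (hreg : IsH1RegularOn (Ioo α β) u) :
    limsup (fun t => eH1NormSq (u t)) (𝓝[<] β) < ⊤ := by
  set t₀ : ℝ := (α + β) / 2 with ht₀
  have ht₀m : t₀ ∈ Ioo α β := ⟨by rw [ht₀]; linarith, by rw [ht₀]; linarith⟩
  have ht₀0 : 0 < t₀ := hα.trans_lt ht₀m.1
  set y₀ : ℝ≥0∞ := eWeakGradL2Sq (u t₀) with hy₀
  have hy₀top : y₀ < ⊤ := lt_of_le_of_lt le_add_self (hreg.eH1NormSq_lt_top ht₀m)
  set K : ℝ≥0∞ := ENNReal.ofReal (Real.exp (4 * (∫⁻ σ in Ioo t₀ β, ENNReal.ofReal (m σ)).toReal)) * y₀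
    with hK
  have hKtop : K < ⊤ := ENNReal.mul_lt_top ENNReal.ofReal_lt_top hy₀top
  have hfinβ : ∫⁻ σ in Ioo t₀ β, ENNReal.ofReal (m σ) ≠ ⊤ :=
    ne_top_of_le_ne_top hAβ (lintegral_mono_set (Ioo_subset_Ioo_left ht₀0.le))
  have hbound : ∀ t ∈ Ico t₀ β, eWeakGradL2Sq (u t) ≤ K := by
    intro t ht
    refine (eWeakGradL2Sq_le_exp_of_midStrain_sup hL2 hc hν hLH hcl hm0 hmaj hA hα hβ hreg ht₀m ht).trans ?_
    refine mul_le_mul' (ENNReal.ofReal_le_ofReal (Real.exp_le_exp.2 ?_)) le_rfl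
    refine mul_le_mul_of_nonneg_left (ENNReal.toReal_mono hfinβ (lintegral_mono_set
      (Ioo_subset_Ioo_right ht.2.le))) (by norm_num)
  set E₀ : ℝ≥0∞ := ENNReal.ofReal (2 * VectorCalculus.kineticEnergy u₀) with hE₀
  have hev : ∀ᶠ t in 𝓝[<] β, eH1NormSq (u t) ≤ E₀ + K := by
    filter_upwards [Ioo_mem_nhdsLT ht₀m.2] with t ht
    have htT : t ∈ Icc 0 T := ⟨(hα.trans ht₀m.1.le).trans ht.1.le, ht.2.le.trans hβ⟩
    exact add_le_add (hLH.eEnergy_le_datum hν.le htT) (hbound t ⟨ht.1.le, ht.2⟩)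
  refine lt_of_le_of_lt (Filter.limsup_le_of_le (by isBoundedDefault) hev) ?_
  exact ENNReal.add_lt_top.2 ⟨ENNReal.ofReal_lt_top, hKtop⟩

/-- **`H¹`-regularity up to (not including) `T`**: a classical Leray–Hopf solution on `[0,T)` with a time-only
middle-strain majorant integrable on every `[0, b]`, `b < T`, is `H¹`-regular on `(0, T)` (Leray's continuation
theorem on every `[0, b]`). [cite: Miller2019, Thm 1.1 (proof of Thm 5.2)]
[cite: RobinsonRodrigoSadowski2016, Thm. 8.17 with Lemma 8.16] -/
theorem isH1RegularOn_Ioo_of_midStrain_sup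
    (hν : 0 < ν) (hT : 0 < T) (hLH : IsLerayHopfOn T ν 0 u₀ u)
    (hcl : IsClassicalNSSolutionOn (Ico 0 T) ν 0 u p)
    {m : ℝ → ℝ} (hm0 : ∀ t, 0 ≤ m t)
    (hmaj : ∀ t ∈ Ico 0 T, ∀ x, ∃ v w : EuclideanSpace ℝ (Fin 3), ‖v‖ = 1 ∧ ‖w‖ = 1 ∧
      ⟪v, w⟫ = 0 ∧ ∀ α β : ℝ,
        ⟪fderiv ℝ (u t) x (α • v + β • w), α • v + β • w⟫ ≤ m t * (α ^ 2 + β ^ 2))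
    (hA : ∀ b < T, ∫⁻ t in Ioo 0 b, ENNReal.ofReal (m t) ≠ ⊤) :
    IsH1RegularOn (Ioo 0 T) u := by
  obtain ⟨c, hc, hL2⟩ := tao2011_H1_local_almost_regular_holds
  -- `H¹`-regular on `(0, b]` for every `b < T`
  have hregb : ∀ b ∈ Ioo 0 T, IsH1RegularOn (Ioc 0 b) u := by
    intro b hb
    have hLHb : IsLerayHopfOn b ν 0 u₀ u := hLH.of_le hb.2.le
    have hclb : IsClassicalNSSolutionOn (Ico 0 b) ν 0 u p :=
      hcl.mono (Ico_subset_Ico_right hb.2.le) (uniqueDiffOn_Ico 0 b)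
    have hAb : ∀ b' < b, ∫⁻ t in Ioo 0 b', ENNReal.ofReal (m t) ≠ ⊤ :=
      fun b' hb' => hA b' (hb'.trans hb.2)
    refine leray_continuation_H1_holds ν b hν hb.1 u₀ u hLHb fun α β hα hαβ hβ hregI => ?_
    exact limsup_eH1NormSq_lt_top_of_midStrain_sup hL2 hc hν hLHb hclb hm0
      (fun t ht x => hmaj t ⟨ht.1, ht.2.trans hb.2⟩ x) hAb hα hαβ hβ
      (ne_top_of_le_ne_top (hA b hb.2) (lintegral_mono_set (Ioo_subset_Ioo_right hβ))) hregI
  refine ⟨fun t ht => ?_, fun t ht => ?_⟩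
  · have hb : (t + T) / 2 ∈ Ioo 0 T := ⟨by linarith [ht.1], by linarith [ht.2]⟩
    exact (hregb _ hb).1 t ⟨ht.1, by linarith [ht.2]⟩
  · have hb : (t + T) / 2 ∈ Ioo 0 T := ⟨by linarith [ht.1], by linarith [ht.2]⟩
    have hcont : ContinuousWithinAt (fun t => eH1NormSq (u t)) (Ioc 0 ((t + T) / 2)) t :=
      (hregb _ hb).2 t ⟨ht.1, by linarith [ht.2]⟩
    refine hcont.mono_of_mem_nhdsWithin ?_
    refine mem_nhdsWithin_of_mem_nhds (mem_of_superset (Ioo_mem_nhds ht.1 (by linarith [ht.2] :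
      t < (t + T) / 2)) Ioo_subset_Ioc_self)

end Literature.Analysis.FluidPDE

end
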